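import Mathlib
import HarnessLib
import Summits.HubbardSuperconductivity.HubbardSuperconductivity.Theorems.KLProgrammeKLRegimeSectorMultiplierPairWtRegime
import Summits.HubbardSuperconductivity.HubbardSuperconductivity.Theorems.KLProgrammeKLRegimeOverlapWtJumpWindow

/-!
# K3 ENGINE child (stmt-HubbardSuperconductivity-20437), stub (b): the WEIGHTED overlap / re-sectorisation constants of
# `E(klAnisoFamily J′)·S(F̃_k)` AT THE FLOW FRAME, **DEEP WINDOW `4ⁿ·U ≤ 4^{2(k+1)+d}`**, in the KL regime, under the binders of
# `E4FlowAt` / `stub_engine_step_norms` — STILL one constant per jump allowance `d`, weight `klScaleWt L M β J′` on the leg positions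

Cell `gate-hubbard-kl`, seat p3 (g11); program «DEEP-WINDOW TWINS» (KL STATUS 2026-08-27 23:19Z), file 2/2: the `cr/cc` twin of
`…AlphaWtFlowDeep`.  p568201 `overlapWt_jump_sums_klEng_flow (d)` (p3 g10, `…SectorMultiplierOverlapWtFlow`) discharges the order-three frame datum
`A₃Λ_m² ≤ 4^d/3072` (`m ≥ k + 1`) on the INTEGER window `n ≤ k + 1 + d` through `Gfr₃·U² ≤ 1`; the same (I-F jets) datum
`‖D³(frameShift K_n)‖ ≤ Gfr₃U²4ⁿ/3` splits as `(Gfr₃U)·(U·4ⁿ)`, so the U-DEPENDENT window **`4ⁿ·U ≤ 4^{2(k+1)+d}`** (depth `n − 2(k+1) ≤ d + log₄U⁻¹`)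
suffices, through `Gfr₃·U ≤ 1` alone (the same door `U ≤ 1/(Gfr₃+1)`).  As for `α_w`, this is the deepest window on which the plain derivative route
keys the weighted overlap constants with an `R`-free, `U`-free constant (finding «W2-HALF»; below it: (F1), k3c3-p2).

* **`overlapWt_jump_sums_klEng_flow_deep (d)`** — `∃ C_J > 0`: p568201's binder list VERBATIM (`G P R Q cc`, `R.WF2`, `0 < cc ≤ klEngC₃6 P R`,
  `μ ∈ klWindowC`, `0 < U ≤ min (klEngU₀3 P R cc) (1/(Gfr₃+1))`, `klBetaMin ≤ β ≤ e^{cc/U²}`, `klEngL₃ β U ≤ L`, `klEngM₃ β U L ≤ M`, `1 ≤ n ≤ n_β + 1`,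
  `HistP klPredsV17F2 … 0 n`, `FrameOK R U n_β μ K_n`, `k + 1 ≤ J′ ≤ n`) with `n ≤ k + 1 + d` replaced by `4ⁿ·U ≤ 4^{2(k+1)+d}`: weighted row sums
  `≤ 81·C_J·M/β`, weighted per-pair position sums (both orientations) `≤ 3·C_J·M/β`;
* `pow_window_overlap_of_nat_window` — the integer window implies the deep one (`U ≤ 1`; note `n ≤ k+1+d ≤ 2(k+1)+d`);
* **`overlapWt_jump_sums_klEng_flow_deep_at (d)`** — the same at ANY EARLIER flow frame `K_m`, `1 ≤ m ≤ n`, `k + 1 ≤ J′ ≤ m`, from the CURRENT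
  history `HistP … 0 n` alone (the telescope-base form; `FrameOK … K_m` from the history by `frameOK_klFlowFrameU_succ` + `FrameOK.mono`).

Everything is proved; no definitions; nothing about the model is asserted. [cite: BenfattoGiulianiMastropietro2006, §2.7 (2.71a), §2.8 (2.77), (2.82)–(2.83)]
-/

noncomputable section

namespace Summit.HubbardSuperconductivity.HubbardSuperconductivity.Theorems.TorusFourierL2

set_option linter.dupNamespace false -- summit = problem name (single-conjunct summit), D-0017

open Set Finset Literature.MathematicalPhysics.QuantumLattice Literature.MathematicalPhysics.QuantumLattice.BandSectorCounting
open Literature.MathematicalPhysics.QuantumLattice.FermiRG Literature.Probability.LatticeModels Literature.Analysis.SpecialFunctions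
open Summit.HubbardSuperconductivity.HubbardSuperconductivity.Theorems.DispersionFlow
open Summit.HubbardSuperconductivity.HubbardSuperconductivity.Theorems.KLRegimeSplit
open Summit.HubbardSuperconductivity.HubbardSuperconductivity.Theorems.KLProgrammeLegKernels
open Summit.HubbardSuperconductivity.HubbardSuperconductivity.Theorems.PerturbedFermiCurve
open scoped Real

open Classical

/-- **The integer window implies the deep window**: `n ≤ k + 1 + d` and `U ≤ 1` give `4ⁿ·U ≤ 4^{2(k+1)+d}`; so the deep-window door below
contains p568201's integer-window door pointwise. [folklore] -/
theorem pow_window_overlap_of_nat_window {U : ℝ} (hU1 : U ≤ 1) {n k dd : ℕ} (h : n ≤ k + 1 + dd) :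
    (4 : ℝ) ^ n * U ≤ (4 : ℝ) ^ (2 * (k + 1) + dd) :=
  calc (4 : ℝ) ^ n * U ≤ (4 : ℝ) ^ n * 1 := mul_le_mul_of_nonneg_left hU1 (by positivity)
    _ = (4 : ℝ) ^ n := mul_one _
    _ ≤ (4 : ℝ) ^ (2 * (k + 1) + dd) := pow_le_pow_right₀ (by norm_num) (by omega)

/-- **The order-three frame datum at a level `m ≥ k + 1` on the deep window**: `Gfr₃·U ≤ 1` and `4^{N+1}·U ≤ 4^{2(k+1)+d}` give
`Gfr₃U²·(4^{N+1}/3)·Λ_m² ≤ 4^d/3072` (`Λ_m = klScale klE0 m = 4^{−m}/32`): the factor `U²` is split as `(Gfr₃U)·(U·4^{N+1})`.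
[cite: BenfattoGiulianiMastropietro2006, §3 (3.3)] -/
theorem frameDatumAt_le_of_pow_window {G₃ U : ℝ} (hU : 0 ≤ U) (hGU : G₃ * U ≤ 1) {N k dd m : ℕ} (hm : k + 1 ≤ m)
    (hwin : (4 : ℝ) ^ (N + 1) * U ≤ (4 : ℝ) ^ (2 * (k + 1) + dd)) :
    G₃ * U ^ 2 * ((4 : ℝ) ^ (N + 1) / 3) * klScale klE0 m ^ 2 ≤ (4 : ℝ) ^ dd / 3072 := by
  have hΛm : klScale klE0 m = (1 / 32) * ((4 : ℝ) ^ m)⁻¹ := by rw [klScale, klE0]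
  have h4 : (0 : ℝ) < (4 : ℝ) ^ m := by positivity
  -- `U·4^{N+1} ≤ 4^{dd}·(4^m)²`
  have hpow : U * (4 : ℝ) ^ (N + 1) ≤ (4 : ℝ) ^ dd * ((4 : ℝ) ^ m) ^ 2 := by
    have h1 : (4 : ℝ) ^ (2 * (k + 1) + dd) ≤ (4 : ℝ) ^ dd * ((4 : ℝ) ^ m) ^ 2 := by
      rw [← pow_mul, ← pow_add]
      exact pow_le_pow_right₀ (by norm_num) (by omega)
    calc U * (4 : ℝ) ^ (N + 1) = (4 : ℝ) ^ (N + 1) * U := mul_comm _ _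
      _ ≤ (4 : ℝ) ^ (2 * (k + 1) + dd) := hwin
      _ ≤ (4 : ℝ) ^ dd * ((4 : ℝ) ^ m) ^ 2 := h1
  rw [hΛm]
  have e : G₃ * U ^ 2 * ((4 : ℝ) ^ (N + 1) / 3) * ((1 / 32) * ((4 : ℝ) ^ m)⁻¹) ^ 2 =
      (G₃ * U) * ((U * (4 : ℝ) ^ (N + 1)) / ((4 : ℝ) ^ m) ^ 2) / 3072 := by
    field_simp
    ring
  rw [e]
  have h2 : (U * (4 : ℝ) ^ (N + 1)) / ((4 : ℝ) ^ m) ^ 2 ≤ (4 : ℝ) ^ dd := by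
    rw [div_le_iff₀ (by positivity)]; exact hpow
  have h3 : (G₃ * U) * ((U * (4 : ℝ) ^ (N + 1)) / ((4 : ℝ) ^ m) ^ 2) ≤ 1 * (4 : ℝ) ^ dd :=
    mul_le_mul hGU h2 (by positivity) zero_le_one
  linarith only [h3]

set_option maxHeartbeats 1600000 in -- long regime bookkeeping
/-- **The WEIGHTED overlap constants of `E(klAnisoFamily J′)·S(F̃_k)` at the flow frame, in the KL regime, DEEP WINDOW `4ⁿ·U ≤ 4^{2(k+1)+d}`**
(see the module docstring): p568201 verbatim with the integer window replaced; one constant per `d`, `R`-free, `U`-free.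
[cite: BenfattoGiulianiMastropietro2006, §2.7 (2.71a), §2.8 (2.77), (2.82)–(2.83)] -/
theorem overlapWt_jump_sums_klEng_flow_deep (dd : ℕ) :
    ∃ CJ : ℝ, 0 < CJ ∧
      ∀ (G : GeoConsts) (P : SplitConsts) (R : RenConsts) (Q : EngConsts) (cc : ℝ), R.WF2 → 0 < cc → cc ≤ EngineV8.klEngC₃6 P R →
      ∀ μ ∈ klWindowC, ∀ U : ℝ, 0 < U → U ≤ min (EngineV8.klEngU₀3 P R cc) (1 / (R.Gfr 3 + 1)) →
      ∀ β : ℝ, klBetaMin ≤ β → β ≤ Real.exp (cc / U ^ 2) →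
      ∀ (L M : ℕ) [NeZero L] [NeZero M], EngineV8.klEngL₃ β U ≤ L → EngineV8.klEngM₃ β U L ≤ M →
      ∀ n : ℕ, 1 ≤ n → n ≤ nScales β + 1 →
        HistP klPredsV17F2 L M G P Q R β U μ 0 n → FrameOK R U (nScales β) μ (klFlowFrameU L M β U μ n) →
        ∀ k J' : ℕ, k + 1 ≤ J' → J' ≤ n → (4 : ℝ) ^ n * U ≤ (4 : ℝ) ^ (2 * (k + 1) + dd) →
        (∀ X'' : SpaceTimeIdx L M × SectorLeg (sectorCount J'),
          ∑ X', ‖(sectorAnalysisMatrix L M β (klAnisoFamily L M β μ (klFlowFrameU L M β U μ n) klE0 J') *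
            sectorSubMatrix L M β (bgmFatMultiplier L M klE0 β (nambuXiCT L μ (klFlowFrameU L M β U μ n)) k)) X'' X'‖ *
              EngineV8.klScaleWt L M β J' {EngineV8.latticeLegPos (2 * (2 * M)) X'', EngineV8.latticeLegPos (2 * (2 * M)) X'} ≤
            81 * CJ * M / β) ∧
        (∀ (ω'' : Fin (sectorCount J')) (ω' : Fin (sectorCount k)) (σ c : Fin 2) (x' : SpaceTimeIdx L M),
          ∑ x'' : SpaceTimeIdx L M, ‖(sectorAnalysisMatrix L M β (klAnisoFamily L M β μ (klFlowFrameU L M β U μ n) klE0 J') *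
            sectorSubMatrix L M β (bgmFatMultiplier L M klE0 β (nambuXiCT L μ (klFlowFrameU L M β U μ n)) k))
              (x'', ((ω'', σ), c)) (x', ((ω', σ), c))‖ *
              EngineV8.klScaleWt L M β J'
                {EngineV8.latticeLegPos (2 * (2 * M)) ((x'', ((ω'', σ), c)) : SpaceTimeIdx L M × SectorLeg (sectorCount J')),
                  EngineV8.latticeLegPos (2 * (2 * M)) ((x', ((ω', σ), c)) : SpaceTimeIdx L M × SectorLeg (sectorCount k))} ≤
            3 * CJ * M / β) ∧
        (∀ (ω'' : Fin (sectorCount J')) (ω' : Fin (sectorCount k)) (σ c : Fin 2) (x'' : SpaceTimeIdx L M),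
          ∑ x' : SpaceTimeIdx L M, ‖(sectorAnalysisMatrix L M β (klAnisoFamily L M β μ (klFlowFrameU L M β U μ n) klE0 J') *
            sectorSubMatrix L M β (bgmFatMultiplier L M klE0 β (nambuXiCT L μ (klFlowFrameU L M β U μ n)) k))
              (x'', ((ω'', σ), c)) (x', ((ω', σ), c))‖ *
              EngineV8.klScaleWt L M β J'
                {EngineV8.latticeLegPos (2 * (2 * M)) ((x'', ((ω'', σ), c)) : SpaceTimeIdx L M × SectorLeg (sectorCount J')),
                  EngineV8.latticeLegPos (2 * (2 * M)) ((x', ((ω', σ), c)) : SpaceTimeIdx L M × SectorLeg (sectorCount k))} ≤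
            3 * CJ * M / β) := by
  have ha : (-4 : ℝ) < -(6 / 5) := by norm_num
  have hab : (-(6 / 5) : ℝ) ≤ -(1 / 10) := by norm_num
  have hb : (-(1 / 10) : ℝ) < 0 := by norm_num
  obtain ⟨CT, hCT, h⟩ := charSumWt_klAnisoPair_nb_of_thresholds ha hab hb ((4 : ℝ) ^ dd / 3072)
  refine ⟨CT + 729 * CT ^ 2 / 2, by positivity, ?_⟩
  intro G P R Q cc hR2 hcc hcc6 μ hμ U hU hUle β hβmin hβc L M _ _ hL3 hM3 n hn1 hnN hhist hfr k J' hJ hJn hnd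
  have hRj : ∀ j, 0 ≤ R.Gfr j := EngineV8.gfr_nonneg_of_wf2 hR2
  have hβ0 : 0 < β := pos_of_klBetaMin_le hβmin
  have hL0 : (0 : ℝ) < L := Nat.cast_pos.2 (Nat.pos_of_ne_zero (NeZero.ne L))
  have hM0 : (0 : ℝ) < M := Nat.cast_pos.2 (Nat.pos_of_ne_zero (NeZero.ne M))
  have hcle := (hcc6.trans (EngineV8.klEngC₃6_le_klEngC₃3 P R)).trans (EngineV8.klEngC₃3_le_symbolC₃ ha hab hb P hRj)
  have hU3 := (hUle.trans (min_le_left _ _)).trans (EngineV8.klEngU₀3_le_symbolU₀ ha hab hb P hRj cc)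
  have hUG : U ≤ 1 / (R.Gfr 3 + 1) := hUle.trans (min_le_right _ _)
  have hLβ : β ^ 2 ≤ (L : ℝ) := EngineV8.sq_le_of_klEngL₃_le hL3
  have hMβ : β ≤ (M : ℝ) := EngineV8.le_of_klEngM₃_le hβmin hL3 hM3
  set K : TrigPolyC4v := klFlowFrameU L M β U μ n with hKdef
  -- the order-three datum of the flow frame from the history's (I-F jets)
  obtain ⟨N, rfl⟩ : ∃ N, n = N + 1 := ⟨n - 1, by omega⟩
  have hh := (histP_klPredsV17F2_iff L M G P Q R β U μ 0 (N + 1)).1 hhist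
  have hJets : ∀ m ≤ N, FlowPieceJetsAt L M β U μ R m := fun m hm => (hh m (Nat.lt_succ_of_le hm)).2.1.2.1
  have hGeo : FlowGeometryAt L M β U μ N := (hh N (Nat.lt_succ_self N)).2.1.2.2
  have hK1 : FrameOK R U N μ K := frameOK_klFlowFrameU_succ hJets hGeo
  have hA3 : ∀ p : Momentum, ‖iteratedFDeriv ℝ 3 (frameShift K) p‖ ≤ R.Gfr 3 * U ^ 2 * ((4 : ℝ) ^ (N + 1) / 3) :=
    (frameShift_high_sizes_of_frameOK hRj hK1).1
  -- the door `U ≤ 1/(Gfr₃+1)` gives `Gfr₃·U ≤ 1` (the deep window needs only this, not `Gfr₃·U² ≤ 1`)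
  have hGU : R.Gfr 3 * U ≤ 1 := by
    have hG3 := hRj 3
    calc R.Gfr 3 * U ≤ R.Gfr 3 * (1 / (R.Gfr 3 + 1)) := mul_le_mul_of_nonneg_left hUG hG3
      _ = R.Gfr 3 / (R.Gfr 3 + 1) := by ring
      _ ≤ 1 := by rw [div_le_one (by positivity)]; linarith only [hG3]
  -- the datum at every level `m ≥ k + 1` on the DEEP window `4ⁿ·U ≤ 4^{2(k+1)+dd}`
  have hdat : ∀ m : ℕ, k + 1 ≤ m → R.Gfr 3 * U ^ 2 * ((4 : ℝ) ^ (N + 1) / 3) * klScale klE0 m ^ 2 ≤ (4 : ℝ) ^ dd / 3072 :=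
    fun m hm => frameDatumAt_le_of_pow_window hU.le hGU hm hnd
  -- the weighted neighbouring bounds on the window `[k + 1, J′]`, weight scale `J′`
  have hT : ∀ m : ℕ, k + 1 ≤ m → m ≤ J' → ∀ (ω : Fin (sectorCount m)) (a' : Fin (sectorCount (m - 1))),
      ∑ z : TorusSite 1 (2 * M) × TorusSite 2 L,
        (1 + klScale klE0 J' * β / (2 * M) * |(((z.1 0).valMinAbs : ℤ) : ℝ)| + klScale klE0 J' * |(((z.2 0).valMinAbs : ℤ) : ℝ)| +
            klScale klE0 J' * |(((z.2 1).valMinAbs : ℤ) : ℝ)|) *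
        ‖∑ q : TorusSite 1 (2 * M) × TorusSite 2 L, (torusChar q.1 z.1 * torusChar q.2 z.2) •
          (klAnisoFamily L M β μ K klE0 m ω (⟨(q.1 0).val, ZMod.val_lt (q.1 0)⟩, q.2) *
            klAnisoFamily L M β μ K klE0 (m - 1) a' (⟨(q.1 0).val, ZMod.val_lt (q.1 0)⟩, q.2))‖ ≤ CT * M * (L : ℝ) ^ 2 := by
    intro m hkm hmJ ω a'
    have hbd := h R hRj cc U hcc hcle hU hU3 β hβmin hβc μ hμ K hfr (R.Gfr 3 * U ^ 2 * ((4 : ℝ) ^ (N + 1) / 3)) hA3 L M hLβ hMβ m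
      (by omega) (by omega) (hdat m hkm) ω a'
    refine le_trans (sum_le_sum fun z _ => mul_le_mul_of_nonneg_right ?_ (norm_nonneg _)) hbd
    have hΛle : klScale klE0 J' ≤ klScale klE0 m := EngineV8.klScale_le_klScale (by norm_num [klE0]) hmJ
    have h0 : 0 ≤ |(((z.1 0).valMinAbs : ℤ) : ℝ)| := abs_nonneg _
    have h1 : 0 ≤ |(((z.2 0).valMinAbs : ℤ) : ℝ)| := abs_nonneg _
    have h2 : 0 ≤ |(((z.2 1).valMinAbs : ℤ) : ℝ)| := abs_nonneg _
    have hβM : 0 ≤ β / (2 * M) := by positivity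
    have hΛ0 : 0 ≤ klScale klE0 J' := (klth_klScale_pos J').le
    have ht : klScale klE0 J' * β / (2 * M) ≤ klScale klE0 m * β / (2 * M) := by
      rw [mul_div_assoc, mul_div_assoc]; exact mul_le_mul_of_nonneg_right hΛle hβM
    gcongr
  -- the windowed jump package and the constants
  have hT0 : 0 ≤ CT * M * (L : ℝ) ^ 2 := by positivity
  obtain ⟨hrow, hcol₁, hrow₁⟩ := overlapWt_jump_sums_le_of_nbWindow (L := L) (M := M) hβ0 μ K (n₀ := k + 1) hT0 hT le_rfl hJ
  have eTJ : CT * M * (L : ℝ) ^ 2 + 729 * ((((2 * M : ℕ) : ℝ) ^ 1 * (L : ℝ) ^ 2)⁻¹ * (CT * M * (L : ℝ) ^ 2) ^ 2) =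
      (CT + 729 * CT ^ 2 / 2) * M * (L : ℝ) ^ 2 := by
    push_cast
    field_simp
  have e81 : ((27 : ℕ) : ℝ) * (3 * ((CT + 729 * CT ^ 2 / 2) * M * (L : ℝ) ^ 2) / (β * (L : ℝ) ^ 2)) =
      81 * (CT + 729 * CT ^ 2 / 2) * M / β := by
    push_cast
    field_simp
    ring
  have e3 : 3 * ((CT + 729 * CT ^ 2 / 2) * M * (L : ℝ) ^ 2) / (β * (L : ℝ) ^ 2) = 3 * (CT + 729 * CT ^ 2 / 2) * M / β := by
    field_simp
  refine ⟨fun X'' => ?_, fun ω'' ω' σ c x' => ?_, fun ω'' ω' σ c x'' => ?_⟩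
  · have h1 := hrow X''
    rw [eTJ, e81] at h1
    exact h1
  · have h1 := hcol₁ ω'' ω' σ c x'
    rw [eTJ, e3] at h1
    exact h1
  · have h1 := hrow₁ ω'' ω' σ c x''
    rw [eTJ, e3] at h1
    exact h1

/-- **The weighted overlap constants at ANY EARLIER flow frame `K_m` (`1 ≤ m ≤ n`, `k + 1 ≤ J′ ≤ m`) from the CURRENT history, deep window at `m`** —
the base form for a frame telescope `K_{m₀} → K_n`: `overlapWt_jump_sums_klEng_flow_deep` at `n := m`, its two frame inputs discharged from
`HistP … 0 n` (`histP_klPredsV17F2_iff` restriction; `frameOK_klFlowFrameU_succ` + `FrameOK.mono`).  Same constant `C_J(d)`.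
[cite: BenfattoGiulianiMastropietro2006, §2.7 (2.71a), §2.8 (2.77), (2.82)–(2.83)] -/
theorem overlapWt_jump_sums_klEng_flow_deep_at (dd : ℕ) :
    ∃ CJ : ℝ, 0 < CJ ∧
      ∀ (G : GeoConsts) (P : SplitConsts) (R : RenConsts) (Q : EngConsts) (cc : ℝ), R.WF2 → 0 < cc → cc ≤ EngineV8.klEngC₃6 P R →
      ∀ μ ∈ klWindowC, ∀ U : ℝ, 0 < U → U ≤ min (EngineV8.klEngU₀3 P R cc) (1 / (R.Gfr 3 + 1)) →
      ∀ β : ℝ, klBetaMin ≤ β → β ≤ Real.exp (cc / U ^ 2) →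
      ∀ (L M : ℕ) [NeZero L] [NeZero M], EngineV8.klEngL₃ β U ≤ L → EngineV8.klEngM₃ β U L ≤ M →
      ∀ n : ℕ, n ≤ nScales β + 1 → HistP klPredsV17F2 L M G P Q R β U μ 0 n →
        ∀ m : ℕ, 1 ≤ m → m ≤ n →
        ∀ k J' : ℕ, k + 1 ≤ J' → J' ≤ m → (4 : ℝ) ^ m * U ≤ (4 : ℝ) ^ (2 * (k + 1) + dd) →
        (∀ X'' : SpaceTimeIdx L M × SectorLeg (sectorCount J'),
          ∑ X', ‖(sectorAnalysisMatrix L M β (klAnisoFamily L M β μ (klFlowFrameU L M β U μ m) klE0 J') *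
            sectorSubMatrix L M β (bgmFatMultiplier L M klE0 β (nambuXiCT L μ (klFlowFrameU L M β U μ m)) k)) X'' X'‖ *
              EngineV8.klScaleWt L M β J' {EngineV8.latticeLegPos (2 * (2 * M)) X'', EngineV8.latticeLegPos (2 * (2 * M)) X'} ≤
            81 * CJ * M / β) ∧
        (∀ (ω'' : Fin (sectorCount J')) (ω' : Fin (sectorCount k)) (σ c : Fin 2) (x' : SpaceTimeIdx L M),
          ∑ x'' : SpaceTimeIdx L M, ‖(sectorAnalysisMatrix L M β (klAnisoFamily L M β μ (klFlowFrameU L M β U μ m) klE0 J') *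
            sectorSubMatrix L M β (bgmFatMultiplier L M klE0 β (nambuXiCT L μ (klFlowFrameU L M β U μ m)) k))
              (x'', ((ω'', σ), c)) (x', ((ω', σ), c))‖ *
              EngineV8.klScaleWt L M β J'
                {EngineV8.latticeLegPos (2 * (2 * M)) ((x'', ((ω'', σ), c)) : SpaceTimeIdx L M × SectorLeg (sectorCount J')),
                  EngineV8.latticeLegPos (2 * (2 * M)) ((x', ((ω', σ), c)) : SpaceTimeIdx L M × SectorLeg (sectorCount k))} ≤
            3 * CJ * M / β) ∧
        (∀ (ω'' : Fin (sectorCount J')) (ω' : Fin (sectorCount k)) (σ c : Fin 2) (x'' : SpaceTimeIdx L M),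
          ∑ x' : SpaceTimeIdx L M, ‖(sectorAnalysisMatrix L M β (klAnisoFamily L M β μ (klFlowFrameU L M β U μ m) klE0 J') *
            sectorSubMatrix L M β (bgmFatMultiplier L M klE0 β (nambuXiCT L μ (klFlowFrameU L M β U μ m)) k))
              (x'', ((ω'', σ), c)) (x', ((ω', σ), c))‖ *
              EngineV8.klScaleWt L M β J'
                {EngineV8.latticeLegPos (2 * (2 * M)) ((x'', ((ω'', σ), c)) : SpaceTimeIdx L M × SectorLeg (sectorCount J')),
                  EngineV8.latticeLegPos (2 * (2 * M)) ((x', ((ω', σ), c)) : SpaceTimeIdx L M × SectorLeg (sectorCount k))} ≤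
            3 * CJ * M / β) := by
  obtain ⟨CJ, hCJ, h⟩ := overlapWt_jump_sums_klEng_flow_deep dd
  refine ⟨CJ, hCJ, ?_⟩
  intro G P R Q cc hR2 hcc hcc6 μ hμ U hU hUle β hβmin hβc L M _ _ hL3 hM3 n hnN hhist m hm1 hmn k J' hJ hJm hwin
  -- the two frame inputs at `m` from the current history
  have hhist' : HistP klPredsV17F2 L M G P Q R β U μ 0 m :=
    (histP_klPredsV17F2_iff L M G P Q R β U μ 0 m).2 fun j hj => (histP_klPredsV17F2_iff L M G P Q R β U μ 0 n).1 hhist j (by omega)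
  have hfr' : FrameOK R U (nScales β) μ (klFlowFrameU L M β U μ m) := by
    obtain ⟨N, rfl⟩ : ∃ N, m = N + 1 := ⟨m - 1, by omega⟩
    have hh := (histP_klPredsV17F2_iff L M G P Q R β U μ 0 n).1 hhist
    have hJt : ∀ m' ≤ N, FlowPieceJetsAt L M β U μ R m' := fun m' hm' => (hh m' (by omega)).2.1.2.1
    have hGe : FlowGeometryAt L M β U μ N := (hh N (by omega)).2.1.2.2
    exact FrameOK.mono (EngineV8.gfr_nonneg_of_wf2 hR2) (by omega) (frameOK_klFlowFrameU_succ hJt hGe)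
  exact h G P R Q cc hR2 hcc hcc6 μ hμ U hU hUle β hβmin hβc L M hL3 hM3 m hm1 (hmn.trans hnN) hhist' hfr' k J' hJ hJm hwin

end Summit.HubbardSuperconductivity.HubbardSuperconductivity.Theorems.TorusFourierL2

end
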